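import Summits.Ventures.QEC.Census.CertCoverReaches
import Summits.Ventures.QEC.Census.BB.BB288.CoverL21D00
import HarnessLib

set_option Elab.async false

/-!
# `[[288,12,18]]` cover certificate — level-2→1 problem 13 (`|s| = 6`, f = 5, 862190 selections):
the `U`-cleared rows and offset as literals (`q13Gc`, `q13c0`, checked against `q13`), for the first-position chunk files.
-/

namespace Summit.Ventures.QEC.Census.BB288Cover

open Summit.Ventures.QEC.Census

/-- `q13.G` with the `U`-bits cleared (DATA; `q13Gc_eq`). -/
def q13Gc : List ℕ :=
  [2361183250439221559520, 1180591625321616509152, 590295823690317956848, 295147914112918618612, 147573957056442927331, 73786989559845730320, 36893501410311940368, 18446752938522063056, 9223376572340648176, 4611699212567132164, 2305852013613416659, 1152925971407177232, 576460889742647476, 288230582310940883, 144115394234956000, 72057800196570336, 36028867919478800, 9016064067973217, 4507999821629488, 2265200111911152, 1134695999876096, 567485472717040, 294669116389376, 154137787106513, 79302309707968, 39790725019888, 30925912295600, 689376313072, 345778962721, 36507455488, 17180114944, 10737577984, 4295176192, 570428992, 268439296, 167774656, 67112128, 8912945, 4456500, 2621479, 1310771]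

/-- `clr U y0` of problem 13. -/
def q13c0 : ℕ := 0

/-- Root check in literal form. -/
theorem q13_root_lit : bzLeaf 5 q13.allow (2 ^ 41) q13c0 = true := by decide +kernel

/-- The literals are the cleared rows / offset of `q13` and the row count is 41. -/
theorem q13Gc_eq : q13.G.map (clr q13.U) = q13Gc ∧ clr q13.U q13.y0 = q13c0 ∧ q13.G.length = 41 ∧ q13.f = 5 := by
  refine ⟨?_, ?_, ?_, ?_⟩ <;> decide +kernel

end Summit.Ventures.QEC.Census.BB288Cover
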